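import Literature.Analysis.FluidPDE.MultiplierHeatPotentialHolder
import Literature.Analysis.FluidPDE.CKNMorreyHolder
import Literature.Analysis.Fourier.HomogeneousSymbolKernelDecay
import HarnessLib

/-!
# Proof of the decay estimates on the kernel of `σ(D)e^{Δ}`; Prop. 13.4 of Lemarié-Rieusset 2016

Analysis/FluidPDE file closing the decomposition of the named fact
`Literature.Analysis.FluidPDE.LemarieRieusset2016.prop13_4` (`ParabolicHeatPotentials.lean`;
Lemarié-Rieusset 2016, Prop. 13.4 p. 464) towards `LemarieRieusset2016.lemma13_6`
(`CKNMorreyLemmas.lean`, Lemma 13.6 p. 477). `MultiplierHeatPotentialHolder.lean` reduced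
Prop. 13.4 to the named fact `LemarieRieusset2016.gaussianMultiplierKernel_estimates` — decay of
`K₁ = 𝓕⁻(σ e^{-4π²|ξ|²})`, of its gradient, and of `2K₁ + ½ u·∇K₁ = -ΔK₁`, for `σ` smooth off the
origin and homogeneous of degree `1` on `ℝ³`. This file **proves** that fact from the general
kernel estimate `Literature.Analysis.Fourier.exists_norm_fourierInv_homogeneous_mul_cgauss_le`
(`|𝓕⁻(τ e^{-a|ξ|²})(u)| ≤ C (1+|u|)^{-(k+d)}` for `τ` homogeneous of degree `k`), applied to the
three symbols `σ` (`k = 1`), `-2πi ⟨ξ, v⟩ σ(ξ)` (`k = 2`, minus the symbol of `∂_v K₁` — the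
`fourierSMulRight` symbol of Mathlib's `Real.hasFDerivAt_fourier`) and `-4π²|ξ|² σ(ξ)` (`k = 3`,
the symbol of `∂_θ K_θ|_{θ=1} = ΔK₁`,
identified with `-(2K₁ + ½ u·∇K₁)` by differentiating the scaling identity
`K_θ(u) = θ⁻² K₁(u/√θ)` (`multiplierHeatKernel_scaling`) at `θ = 1`, the left-hand side under the
integral sign):

* `LemarieRieusset2016.gaussianMultiplierKernel_estimates_holds` — **proved**;
* `LemarieRieusset2016.prop13_4_holds : prop13_4` — **proved** (Prop. 13.4 in full);
* `LemarieRieusset2016.prop13_4_multiplierPart_holds` — **proved** (discharges the named fact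
  `prop13_4_multiplierPart` of `HeatPotentialHolder.lean`);
* `LemarieRieusset2016.lemma13_6_of_duhamel_holds` — Lemma 13.6 now follows from the single
  named fact `lemma13_6_duhamel` (the localisation (13.50)–(13.52)).

## References

* P. G. Lemarié-Rieusset, *The Navier–Stokes Problem in the 21st Century*, CRC Press (2016),
  Prop. 13.4 and its proof, pp. 464–465; Lemma 13.6, p. 477. [LemarieRieusset2016]
* E. M. Stein, *Harmonic Analysis*, Princeton (1993), Ch. VI §4. [Stein1993]
-/

noncomputable section

open MeasureTheory Set Function Filter Metric Real Topology
open scoped NNReal ENNReal RealInnerProductSpace FourierTransform ContDiff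

namespace Literature.Analysis.FluidPDE

/-- Local notation for physical space `ℝ³ = EuclideanSpace ℝ (Fin 3)`. -/
local notation "ℝ³" => EuclideanSpace ℝ (Fin 3)

/-! ### The three symbols -/

section Symbols

variable {σ : ℝ³ → ℂ}

/-- `K₁ = 𝓕⁻(σ · e^{-4π²‖·‖²})` (`Fourier.cgauss_heatSymbol`). [folklore] -/
theorem multiplierHeatKernel_one_eq (σ : ℝ³ → ℂ) :
    multiplierHeatKernel σ 1 = 𝓕⁻ (fun ξ : ℝ³ => σ ξ * Fourier.cgauss ((2 * π) ^ 2) ξ) := by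
  funext y
  rw [multiplierHeatKernel, ← mul_one ((2 * π) ^ 2), Fourier.cgauss_heatSymbol]

/-- A symbol homogeneous of degree `1` vanishes at the origin. [folklore] -/
theorem symbol_zero_of_homogeneous (hhom : ∀ c : ℝ, 0 < c → ∀ ξ : ℝ³, σ (c • ξ) = (c : ℂ) * σ ξ) :
    σ 0 = 0 := by
  have h := hhom 2 two_pos 0
  rw [smul_zero] at h
  push_cast at h
  linear_combination -h

/-- Degree-`1` homogeneity in the form `σ(cξ) = c¹ σ(ξ)`, `ξ ≠ 0`. [folklore] -/
theorem homogeneous_one (hhom : ∀ c : ℝ, 0 < c → ∀ ξ : ℝ³, σ (c • ξ) = (c : ℂ) * σ ξ) :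
    ∀ c : ℝ, 0 < c → ∀ ξ : ℝ³, ξ ≠ 0 → σ (c • ξ) = (c : ℂ) ^ 1 * σ ξ := fun c hc ξ _ => by
  rw [pow_one]; exact hhom c hc ξ

/-- The symbol `-2πi ⟨ξ, v⟩ σ(ξ)`: **minus** the symbol of `∂_v σ(D)` in Mathlib's convention
(it is the `fourierSMulRight` symbol of `Real.hasFDerivAt_fourier`, whence the sign in
`multiplierKernelDeriv_apply`). It equals `-(derivSymbol v ξ) * σ ξ` for the `derivSymbol` of
`HeatKernelMultiplierDerivatives.lean`, and is the `ℝ³`, `σ`-weighted instance of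
`Literature.Analysis.FunctionSpaces.derivSymbol` (`BMOBesovProofs.lean`); a local copy is kept to
avoid importing either file (import weight; the former is a sibling support file of
`lemma13_6_duhamel`). [folklore] -/
def multiplierDerivSymbol (σ : ℝ³ → ℂ) (v : ℝ³) (ξ : ℝ³) : ℂ := -(2 * π * Complex.I) * ((⟪ξ, v⟫ : ℝ) : ℂ) * σ ξ

/-- The symbol `-4π² ‖ξ‖² σ(ξ)` of `Δ σ(D)` (`= ∂_θ` of the symbol `σ e^{-4π²θ‖ξ‖²}` at `θ = 1`).
[folklore] -/
def multiplierLaplaceSymbol (σ : ℝ³ → ℂ) (ξ : ℝ³) : ℂ := σ ξ * ((-(2 * π) ^ 2 * ‖ξ‖ ^ 2 : ℝ) : ℂ)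

/-- `multiplierDerivSymbol σ v` is smooth off the origin. [folklore] -/
theorem contDiffOn_multiplierDerivSymbol (hσ : ContDiffOn ℝ ∞ σ {0}ᶜ) (v : ℝ³) :
    ContDiffOn ℝ ∞ (multiplierDerivSymbol σ v) {0}ᶜ := by
  have h1 : ContDiff ℝ ∞ (fun ξ : ℝ³ => ((⟪ξ, v⟫ : ℝ) : ℂ)) :=
    Complex.ofRealCLM.contDiff.comp (contDiff_id.inner ℝ contDiff_const)
  exact (contDiffOn_const.mul h1.contDiffOn).mul hσ

/-- `multiplierLaplaceSymbol σ` is smooth off the origin. [folklore] -/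
theorem contDiffOn_multiplierLaplaceSymbol (hσ : ContDiffOn ℝ ∞ σ {0}ᶜ) :
    ContDiffOn ℝ ∞ (multiplierLaplaceSymbol σ) {0}ᶜ := by
  have h1 : ContDiff ℝ ∞ (fun ξ : ℝ³ => ((-(2 * π) ^ 2 * ‖ξ‖ ^ 2 : ℝ) : ℂ)) :=
    Complex.ofRealCLM.contDiff.comp (contDiff_const.mul (contDiff_norm_sq ℝ))
  exact hσ.mul h1.contDiffOn

/-- `multiplierDerivSymbol σ v` is homogeneous of degree `2`. [folklore] -/
theorem multiplierDerivSymbol_homogeneous (hhom : ∀ c : ℝ, 0 < c → ∀ ξ : ℝ³, σ (c • ξ) = (c : ℂ) * σ ξ)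
    (v : ℝ³) : ∀ c : ℝ, 0 < c → ∀ ξ : ℝ³, ξ ≠ 0 →
      multiplierDerivSymbol σ v (c • ξ) = (c : ℂ) ^ 2 * multiplierDerivSymbol σ v ξ := by
  intro c hc ξ _
  simp only [multiplierDerivSymbol, real_inner_smul_left, hhom c hc ξ]
  push_cast
  ring

/-- `multiplierLaplaceSymbol σ` is homogeneous of degree `3`. [folklore] -/
theorem multiplierLaplaceSymbol_homogeneous (hhom : ∀ c : ℝ, 0 < c → ∀ ξ : ℝ³, σ (c • ξ) = (c : ℂ) * σ ξ) :
    ∀ c : ℝ, 0 < c → ∀ ξ : ℝ³, ξ ≠ 0 →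
      multiplierLaplaceSymbol σ (c • ξ) = (c : ℂ) ^ 3 * multiplierLaplaceSymbol σ ξ := by
  intro c hc ξ _
  simp only [multiplierLaplaceSymbol, norm_smul, Real.norm_eq_abs, abs_of_pos hc, hhom c hc ξ]
  push_cast
  ring

/-- `multiplierDerivSymbol σ v 0 = 0`. [folklore] -/
theorem multiplierDerivSymbol_zero (σ : ℝ³ → ℂ) (v : ℝ³) : multiplierDerivSymbol σ v 0 = 0 := by
  simp [multiplierDerivSymbol]

/-- `multiplierLaplaceSymbol σ 0 = 0`. [folklore] -/
theorem multiplierLaplaceSymbol_zero (σ : ℝ³ → ℂ) : multiplierLaplaceSymbol σ 0 = 0 := by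
  simp [multiplierLaplaceSymbol]

end Symbols

/-! ### The derivative of `K₁` and the identity `2K₁ + ½ u·∇K₁ = -ΔK₁` -/

section Derivative

variable {σ : ℝ³ → ℂ}

/-- Order-zero bound `|σ(ξ)| ≤ T₀ ‖ξ‖` of a degree-`1` homogeneous symbol smooth off the
origin. [folklore] -/
theorem exists_norm_symbol_le (hσ : ContDiffOn ℝ ∞ σ {0}ᶜ)
    (hhom : ∀ c : ℝ, 0 < c → ∀ ξ : ℝ³, σ (c • ξ) = (c : ℂ) * σ ξ) :
    ∃ T₀ : ℝ, 0 ≤ T₀ ∧ ∀ ξ : ℝ³, ‖σ ξ‖ ≤ T₀ * ‖ξ‖ := by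
  obtain ⟨T₀, hT₀, hT⟩ := Fourier.exists_norm_iteratedFDeriv_homogeneous_le hσ (homogeneous_one hhom) 0
  refine ⟨T₀, hT₀, fun ξ => ?_⟩
  by_cases hξ : ξ = 0
  · rw [hξ, symbol_zero_of_homogeneous hhom, norm_zero, norm_zero, mul_zero]
  · simpa using Fourier.norm_homogeneous_le (k := 1) hT hξ

/-- The symbol `m = σ e^{-4π²‖·‖²}` and its first moment are integrable. [folklore] -/
theorem integrable_symbol_mul_cgauss (hσ : ContDiffOn ℝ ∞ σ {0}ᶜ)
    (hhom : ∀ c : ℝ, 0 < c → ∀ ξ : ℝ³, σ (c • ξ) = (c : ℂ) * σ ξ) :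
    Integrable (fun ξ : ℝ³ => σ ξ * Fourier.cgauss ((2 * π) ^ 2) ξ) ∧
      Integrable (fun ξ : ℝ³ => ‖ξ‖ * ‖σ ξ * Fourier.cgauss ((2 * π) ^ 2) ξ‖) := by
  obtain ⟨T₀, hT₀, hT⟩ := exists_norm_symbol_le hσ hhom
  have ha : 0 < (2 * π) ^ 2 := by positivity
  have hm : Measurable σ := Fourier.measurable_of_contDiffOn_compl_zero hσ
  have hmeas : AEStronglyMeasurable (fun ξ : ℝ³ => σ ξ * Fourier.cgauss ((2 * π) ^ 2) ξ) volume :=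
    (hm.mul (Fourier.contDiff_cgauss _ (n := 0)).continuous.measurable).aestronglyMeasurable
  constructor
  · refine ((Fourier.integrable_norm_pow_mul_exp_neg_mul_norm_sq ha 1).const_mul T₀).mono' hmeas
      (Eventually.of_forall fun ξ => ?_)
    rw [norm_mul, Fourier.norm_cgauss, pow_one]
    calc ‖σ ξ‖ * Real.exp (-(2 * π) ^ 2 * ‖ξ‖ ^ 2) ≤ T₀ * ‖ξ‖ * Real.exp (-(2 * π) ^ 2 * ‖ξ‖ ^ 2) := by
          gcongr; exact hT ξ
      _ = T₀ * (‖ξ‖ * Real.exp (-(2 * π) ^ 2 * ‖ξ‖ ^ 2)) := by ring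
  · refine ((Fourier.integrable_norm_pow_mul_exp_neg_mul_norm_sq ha 2).const_mul T₀).mono'
      (continuous_norm.aestronglyMeasurable.mul hmeas.norm) (Eventually.of_forall fun ξ => ?_)
    rw [Real.norm_eq_abs, abs_of_nonneg (by positivity), norm_mul, Fourier.norm_cgauss]
    calc ‖ξ‖ * (‖σ ξ‖ * Real.exp (-(2 * π) ^ 2 * ‖ξ‖ ^ 2))
        ≤ ‖ξ‖ * (T₀ * ‖ξ‖ * Real.exp (-(2 * π) ^ 2 * ‖ξ‖ ^ 2)) := by gcongr; exact hT ξ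
      _ = T₀ * (‖ξ‖ ^ 2 * Real.exp (-(2 * π) ^ 2 * ‖ξ‖ ^ 2)) := by ring

/-- The derivative of `K₁ = 𝓕⁻ m`, `m = σ e^{-4π²‖·‖²}`: the Fréchet derivative of
`w ↦ 𝓕 m (-w)` (Mathlib's `Real.hasFDerivAt_fourier` composed with `w ↦ -w`). [folklore] -/
def multiplierKernelDeriv (σ : ℝ³ → ℂ) (u : ℝ³) : ℝ³ →L[ℝ] ℂ :=
  (𝓕 (VectorFourier.fourierSMulRight (innerSL ℝ)
      (fun ξ : ℝ³ => σ ξ * Fourier.cgauss ((2 * π) ^ 2) ξ)) (-u)).comp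
    (-ContinuousLinearMap.id ℝ ℝ³)

/-- `K₁` is differentiable with derivative `multiplierKernelDeriv σ`. [folklore] -/
theorem hasFDerivAt_multiplierHeatKernel_one (hσ : ContDiffOn ℝ ∞ σ {0}ᶜ)
    (hhom : ∀ c : ℝ, 0 < c → ∀ ξ : ℝ³, σ (c • ξ) = (c : ℂ) * σ ξ) (u : ℝ³) :
    HasFDerivAt (multiplierHeatKernel σ 1) (multiplierKernelDeriv σ u) u := by
  obtain ⟨hint, hint1⟩ := integrable_symbol_mul_cgauss hσ hhom
  have heq : multiplierHeatKernel σ 1 =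
      (𝓕 (fun ξ : ℝ³ => σ ξ * Fourier.cgauss ((2 * π) ^ 2) ξ)) ∘ fun w : ℝ³ => -w := by
    rw [multiplierHeatKernel_one_eq]
    funext w
    exact Real.fourierInv_eq_fourier_neg _ w
  rw [heq]
  exact (Real.hasFDerivAt_fourier hint hint1 (-u)).comp u (hasFDerivAt_id u).neg

/-- **The derivative is the kernel of the symbol `-2πi⟨ξ, v⟩σ`**:
`multiplierKernelDeriv σ u v = -𝓕⁻(multiplierDerivSymbol σ v · e^{-4π²‖·‖²})(u)`. [folklore] -/
theorem multiplierKernelDeriv_apply (hσ : ContDiffOn ℝ ∞ σ {0}ᶜ)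
    (hhom : ∀ c : ℝ, 0 < c → ∀ ξ : ℝ³, σ (c • ξ) = (c : ℂ) * σ ξ) (u v : ℝ³) :
    multiplierKernelDeriv σ u v =
      -𝓕⁻ (fun ξ : ℝ³ => multiplierDerivSymbol σ v ξ * Fourier.cgauss ((2 * π) ^ 2) ξ) u := by
  obtain ⟨hint, hint1⟩ := integrable_symbol_mul_cgauss hσ hhom
  have hF : Integrable (VectorFourier.fourierSMulRight (innerSL ℝ)
      (fun ξ : ℝ³ => σ ξ * Fourier.cgauss ((2 * π) ^ 2) ξ)) := by
    refine (hint1.const_mul (2 * π * ‖innerSL ℝ (E := ℝ³)‖)).mono'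
      hint.1.fourierSMulRight (Eventually.of_forall fun ξ => ?_)
    refine (VectorFourier.norm_fourierSMulRight_le _ _ _).trans (le_of_eq ?_)
    ring
  have hfun : (fun ξ : ℝ³ => VectorFourier.fourierSMulRight (innerSL ℝ)
      (fun ξ : ℝ³ => σ ξ * Fourier.cgauss ((2 * π) ^ 2) ξ) ξ v) =
      fun ξ : ℝ³ => multiplierDerivSymbol σ v ξ * Fourier.cgauss ((2 * π) ^ 2) ξ := by
    funext ξ
    rw [VectorFourier.fourierSMulRight_apply, innerSL_apply_apply, multiplierDerivSymbol, Complex.real_smul,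
      smul_eq_mul]
    ring
  rw [multiplierKernelDeriv, ContinuousLinearMap.comp_apply, neg_apply,
    ContinuousLinearMap.id_apply, map_neg, Real.fourier_continuousLinearMap_apply hF,
    ← Real.fourierInv_eq_fourier_neg, hfun]

/-- **The `θ`-derivative of `K_θ(u) = 𝓕⁻(σ e^{-4π²θ‖·‖²})(u)` at `θ = 1` under the integral sign**:
it is the kernel of the symbol `-4π²‖ξ‖² σ` (dominated differentiation,
`|∂_θ| ≤ T₀ 4π² ‖ξ‖³ e^{-2π²‖ξ‖²}` for `θ > 1/2`). [folklore] -/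
theorem hasDerivAt_multiplierHeatKernel_theta (hσ : ContDiffOn ℝ ∞ σ {0}ᶜ)
    (hhom : ∀ c : ℝ, 0 < c → ∀ ξ : ℝ³, σ (c • ξ) = (c : ℂ) * σ ξ) (u : ℝ³) :
    HasDerivAt (fun θ : ℝ => multiplierHeatKernel σ θ u)
      (𝓕⁻ (fun ξ : ℝ³ => multiplierLaplaceSymbol σ ξ * Fourier.cgauss ((2 * π) ^ 2) ξ) u) 1 := by
  obtain ⟨T₀, hT₀, hT⟩ := exists_norm_symbol_le hσ hhom
  have hm : Measurable σ := Fourier.measurable_of_contDiffOn_compl_zero hσ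
  -- integrand and its derivative
  set e : ℝ³ → ℂ := fun v => ((𝐞 ⟪v, u⟫ : Circle) : ℂ) with he
  have he_cont : Continuous e :=
    continuous_subtype_val.comp (Real.continuous_fourierChar.comp (continuous_id.inner continuous_const))
  have he_norm : ∀ v, ‖e v‖ = 1 := fun v => Circle.norm_coe _
  set F : ℝ → ℝ³ → ℂ := fun θ v =>
    e v * (σ v * ((Real.exp (-(2 * π) ^ 2 * θ * ‖v‖ ^ 2) : ℝ) : ℂ)) with hF
  set F' : ℝ → ℝ³ → ℂ := fun θ v =>
    e v * (σ v * ((-(2 * π) ^ 2 * ‖v‖ ^ 2 * Real.exp (-(2 * π) ^ 2 * θ * ‖v‖ ^ 2) : ℝ) : ℂ)) with hF'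
  have hFeq : (fun θ : ℝ => multiplierHeatKernel σ θ u) = fun θ => ∫ v, F θ v := by
    funext θ
    rw [multiplierHeatKernel, Real.fourierInv_eq]
    refine integral_congr_ae (Eventually.of_forall fun v => ?_)
    simp only [hF, he, Circle.smul_def, smul_eq_mul, UnboundedOperators.heatSymbol]
  have hF'1 : ∫ v, F' 1 v = 𝓕⁻ (fun ξ : ℝ³ => multiplierLaplaceSymbol σ ξ * Fourier.cgauss ((2 * π) ^ 2) ξ) u := by
    rw [Real.fourierInv_eq]
    refine integral_congr_ae (Eventually.of_forall fun v => ?_)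
    simp only [hF', he, Circle.smul_def, smul_eq_mul, multiplierLaplaceSymbol, Fourier.cgauss, mul_one]
    push_cast
    ring
  -- measurability
  have hmeasF : ∀ θ, AEStronglyMeasurable (F θ) volume := fun θ => by
    have : Continuous fun v : ℝ³ => ((Real.exp (-(2 * π) ^ 2 * θ * ‖v‖ ^ 2) : ℝ) : ℂ) := by fun_prop
    exact (he_cont.measurable.mul (hm.mul this.measurable)).aestronglyMeasurable
  have hmeasF' : ∀ θ, AEStronglyMeasurable (F' θ) volume := fun θ => by
    have : Continuous fun v : ℝ³ =>
        ((-(2 * π) ^ 2 * ‖v‖ ^ 2 * Real.exp (-(2 * π) ^ 2 * θ * ‖v‖ ^ 2) : ℝ) : ℂ) := by fun_prop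
    exact (he_cont.measurable.mul (hm.mul this.measurable)).aestronglyMeasurable
  -- integrability of `F 1`
  obtain ⟨hint, -⟩ := integrable_symbol_mul_cgauss hσ hhom
  have hF1 : Integrable (F 1) := by
    refine hint.mono (hmeasF 1) (Eventually.of_forall fun v => ?_)
    rw [hF]
    simp only [norm_mul, he_norm, one_mul, Fourier.cgauss, mul_one]
    exact le_rfl
  -- the bound
  set bound : ℝ³ → ℝ := fun v => T₀ * (2 * π) ^ 2 * (‖v‖ ^ 3 * Real.exp (-((2 * π) ^ 2 / 2) * ‖v‖ ^ 2))
    with hbound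
  have hbound_int : Integrable bound :=
    (Fourier.integrable_norm_pow_mul_exp_neg_mul_norm_sq (by positivity) 3).const_mul _
  have hball : ball (1 : ℝ) (1 / 2) ∈ 𝓝 (1 : ℝ) := ball_mem_nhds _ (by norm_num)
  have h_bound : ∀ᵐ v ∂volume, ∀ θ ∈ ball (1 : ℝ) (1 / 2), ‖F' θ v‖ ≤ bound v := by
    refine Eventually.of_forall fun v θ hθ => ?_
    rw [mem_ball, Real.dist_eq, abs_lt] at hθ
    have hθ' : 1 / 2 < θ := by linarith
    rw [hF']
    simp only [norm_mul, he_norm, one_mul, Complex.norm_real, Real.norm_eq_abs]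
    rw [abs_of_neg (neg_neg_of_pos (by positivity)), neg_neg,
      abs_of_nonneg (by positivity : (0 : ℝ) ≤ ‖v‖ ^ 2), abs_of_pos (Real.exp_pos _)]
    have hexp : Real.exp (-(2 * π) ^ 2 * θ * ‖v‖ ^ 2) ≤ Real.exp (-((2 * π) ^ 2 / 2) * ‖v‖ ^ 2) := by
      refine Real.exp_le_exp.2 ?_
      nlinarith [sq_nonneg ‖v‖, sq_nonneg π, mul_nonneg (sq_nonneg π) (sq_nonneg ‖v‖)]
    calc ‖σ v‖ * ((2 * π) ^ 2 * ‖v‖ ^ 2 * Real.exp (-(2 * π) ^ 2 * θ * ‖v‖ ^ 2))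
        ≤ (T₀ * ‖v‖) * (((2 * π) ^ 2 * ‖v‖ ^ 2) * Real.exp (-((2 * π) ^ 2 / 2) * ‖v‖ ^ 2)) := by
          refine mul_le_mul (hT v) ?_ (by positivity) (by positivity)
          exact mul_le_mul_of_nonneg_left hexp (by positivity)
      _ = bound v := by rw [hbound]; ring
  -- differentiability of the integrand
  have h_diff : ∀ᵐ v ∂volume, ∀ θ ∈ ball (1 : ℝ) (1 / 2), HasDerivAt (F · v) (F' θ v) θ := by
    refine Eventually.of_forall fun v θ _ => ?_
    have h1 : HasDerivAt (fun θ : ℝ => -(2 * π) ^ 2 * θ * ‖v‖ ^ 2) (-(2 * π) ^ 2 * ‖v‖ ^ 2) θ := by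
      have := ((hasDerivAt_id θ).const_mul (-(2 * π) ^ 2)).mul_const (‖v‖ ^ 2)
      simpa using this
    have h2 : HasDerivAt (fun θ : ℝ => Real.exp (-(2 * π) ^ 2 * θ * ‖v‖ ^ 2))
        (Real.exp (-(2 * π) ^ 2 * θ * ‖v‖ ^ 2) * (-(2 * π) ^ 2 * ‖v‖ ^ 2)) θ := h1.exp
    have h3 : HasDerivAt (fun θ : ℝ => ((Real.exp (-(2 * π) ^ 2 * θ * ‖v‖ ^ 2) : ℝ) : ℂ))
        (((Real.exp (-(2 * π) ^ 2 * θ * ‖v‖ ^ 2) * (-(2 * π) ^ 2 * ‖v‖ ^ 2) : ℝ) : ℂ)) θ :=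
      h2.ofReal_comp
    have h4 := (h3.const_mul (σ v)).const_mul (e v)
    refine h4.congr_deriv ?_
    simp only [hF']
    push_cast
    ring
  have hmain := (hasDerivAt_integral_of_dominated_loc_of_deriv_le hball
    (Eventually.of_forall hmeasF) hF1 (hmeasF' 1) h_bound hbound_int h_diff).2
  rw [hFeq, ← hF'1]
  exact hmain

/-- **The `θ`-derivative of `θ⁻² K₁(u/√θ)` at `θ = 1` is `-(2K₁(u) + ½ ∇K₁(u)·u)`**, so by the
scaling identity `K_θ(u) = θ⁻² K₁(u/√θ)` and uniqueness of derivatives,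
`2K₁(u) + ½ ∇K₁(u)·u = -𝓕⁻(multiplierLaplaceSymbol σ · e^{-4π²‖·‖²})(u) = -ΔK₁(u)`. [folklore] -/
theorem two_mul_add_half_multiplierKernelDeriv_eq (hσ : ContDiffOn ℝ ∞ σ {0}ᶜ)
    (hhom : ∀ c : ℝ, 0 < c → ∀ ξ : ℝ³, σ (c • ξ) = (c : ℂ) * σ ξ) (u : ℝ³) :
    2 * multiplierHeatKernel σ 1 u + (1 / 2 : ℂ) * multiplierKernelDeriv σ u u =
      -𝓕⁻ (fun ξ : ℝ³ => multiplierLaplaceSymbol σ ξ * Fourier.cgauss ((2 * π) ^ 2) ξ) u := by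
  have hd := hasFDerivAt_multiplierHeatKernel_one hσ hhom
  -- the derivative of the rescaled form
  have h1 := hasDerivAt_rescaled_time (K₁ := multiplierHeatKernel σ 1) (D := multiplierKernelDeriv σ) hd
    one_pos one_pos u
  simp only [one_mul, Real.one_rpow, one_pow, one_smul, neg_smul] at h1
  -- it agrees with `θ ↦ K_θ(u)` near `θ = 1`
  have hev : (fun θ : ℝ => multiplierHeatKernel σ θ u) =ᶠ[𝓝 1]
      fun s : ℝ => ((1 * s) ^ (-(1 / 2 : ℝ))) ^ 4 • multiplierHeatKernel σ 1 ((1 * s) ^ (-(1 / 2 : ℝ)) • u) := by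
    filter_upwards [Ioi_mem_nhds (zero_lt_one' ℝ)] with s hs
    rw [one_mul, multiplierHeatKernel_scaling hhom hs u, rpow_neg_half_pow_four hs,
      rpow_neg_half_eq_inv_sqrt hs]
  have h2 : HasDerivAt (fun θ : ℝ => multiplierHeatKernel σ θ u)
      (-(2 * multiplierHeatKernel σ 1 u + (1 / 2 : ℂ) * multiplierKernelDeriv σ u u)) 1 := by
    have h1' : HasDerivAt (fun s : ℝ => ((1 * s) ^ (-(1 / 2 : ℝ))) ^ 4 •
        multiplierHeatKernel σ 1 ((1 * s) ^ (-(1 / 2 : ℝ)) • u))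
        (-(2 * multiplierHeatKernel σ 1 u + (1 / 2 : ℂ) * multiplierKernelDeriv σ u u)) 1 := by
      convert h1 using 2; simp
    exact h1'.congr_of_eventuallyEq hev
  have h3 := hasDerivAt_multiplierHeatKernel_theta hσ hhom u
  have := h2.unique h3
  linear_combination -this

end Derivative

/-! ### The estimates -/

namespace LemarieRieusset2016

/-- **Lemarié-Rieusset 2016, Prop. 13.4, proof p. 465 — the decay estimates on `K₁`, proved**:
`gaussianMultiplierKernel_estimates` holds. The three bounds are
`exists_norm_fourierInv_homogeneous_mul_cgauss_le` for the symbols `σ` (`k = 1`),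
`-2πi⟨ξ, eⱼ⟩σ` (`k = 2`, through an orthonormal basis and `multiplierKernelDeriv_apply`) and `-4π²|ξ|²σ`
(`k = 3`, through `two_mul_add_half_multiplierKernelDeriv_eq`) on `ℝ³` (`d = 3`).
[cite: LemarieRieusset2016, Prop. 13.4 proof p. 465] -/
theorem gaussianMultiplierKernel_estimates_holds : gaussianMultiplierKernel_estimates := by
  intro σ hσ hhom
  have ha : 0 < (2 * π) ^ 2 := by positivity
  have h0 := symbol_zero_of_homogeneous hhom
  have hd3 : Module.finrank ℝ (EuclideanSpace ℝ (Fin 3)) = 3 := finrank_euclideanSpace_fin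
  -- size
  obtain ⟨C₁, hC₁⟩ := Fourier.exists_norm_fourierInv_homogeneous_mul_cgauss_le hσ
    (homogeneous_one hhom) h0 ha
  -- gradient, through the standard basis
  set b := EuclideanSpace.basisFun (Fin 3) ℝ with hb
  have hex := fun i : Fin 3 => Fourier.exists_norm_fourierInv_homogeneous_mul_cgauss_le
    (contDiffOn_multiplierDerivSymbol hσ (b i)) (multiplierDerivSymbol_homogeneous hhom (b i)) (multiplierDerivSymbol_zero σ (b i)) ha
  choose Cd hCd using hex
  -- Laplacian
  obtain ⟨C₃, hC₃⟩ := Fourier.exists_norm_fourierInv_homogeneous_mul_cgauss_le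
    (contDiffOn_multiplierLaplaceSymbol hσ) (multiplierLaplaceSymbol_homogeneous hhom) (multiplierLaplaceSymbol_zero σ) ha
  refine ⟨multiplierKernelDeriv σ, max C₁ (max (∑ i, Cd i) C₃), hasFDerivAt_multiplierHeatKernel_one hσ hhom,
    fun u => ?_, fun u => ?_, fun u => ?_⟩
  · -- `|K₁(u)|(1+|u|)⁴ ≤ C₁`
    refine le_trans ?_ (le_max_left _ _)
    have := hC₁ u
    rw [hd3, ← multiplierHeatKernel_one_eq] at this
    exact this
  · -- `‖∇K₁(u)‖(1+|u|)⁵ ≤ Σ Cd i`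
    refine le_trans ?_ ((le_max_left _ _).trans (le_max_right _ _))
    have hcoord : ∀ i, ‖multiplierKernelDeriv σ u (b i)‖ * (1 + ‖u‖) ^ 5 ≤ Cd i := fun i => by
      have := hCd i u
      rw [hd3] at this
      rwa [multiplierKernelDeriv_apply hσ hhom, norm_neg]
    have hop : ‖multiplierKernelDeriv σ u‖ ≤ ∑ i, ‖multiplierKernelDeriv σ u (b i)‖ := by
      refine ContinuousLinearMap.opNorm_le_bound _ (Finset.sum_nonneg fun i _ => norm_nonneg _)
        fun v => ?_
      calc ‖multiplierKernelDeriv σ u v‖ = ‖multiplierKernelDeriv σ u (∑ i, v i • b i)‖ := by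
            congr 2
            conv_lhs => rw [← b.sum_repr v]
            simp [hb]
        _ = ‖∑ i, v i • multiplierKernelDeriv σ u (b i)‖ := by simp [map_sum, map_smul]
        _ ≤ ∑ i, ‖v i • multiplierKernelDeriv σ u (b i)‖ := norm_sum_le _ _
        _ ≤ ∑ i, ‖v‖ * ‖multiplierKernelDeriv σ u (b i)‖ := by
            refine Finset.sum_le_sum fun i _ => ?_
            rw [norm_smul]
            exact mul_le_mul_of_nonneg_right (by simpa using PiLp.norm_apply_le v i) (norm_nonneg _)
        _ = (∑ i, ‖multiplierKernelDeriv σ u (b i)‖) * ‖v‖ := by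
            rw [Finset.sum_mul]; exact Finset.sum_congr rfl fun i _ => mul_comm _ _
    calc ‖multiplierKernelDeriv σ u‖ * (1 + ‖u‖) ^ 5 ≤ (∑ i, ‖multiplierKernelDeriv σ u (b i)‖) * (1 + ‖u‖) ^ 5 := by
          gcongr
      _ = ∑ i, ‖multiplierKernelDeriv σ u (b i)‖ * (1 + ‖u‖) ^ 5 := Finset.sum_mul _ _ _
      _ ≤ ∑ i, Cd i := Finset.sum_le_sum fun i _ => hcoord i
  · -- `|2K₁ + ½ ∇K₁·u|(1+|u|)⁶ ≤ C₃`
    refine le_trans ?_ ((le_max_right _ _).trans (le_max_right _ _))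
    have := hC₃ u
    rw [hd3] at this
    rwa [two_mul_add_half_multiplierKernelDeriv_eq hσ hhom, norm_neg]

/-- **Lemarié-Rieusset 2016, Prop. 13.4 (p. 464), proved**: parabolic Hölder regularity of
`∫₀ᵗ W_{ν(t-s)} ∗ (f + σ(D)g) ds` for Morrey data. [cite: LemarieRieusset2016, Prop. 13.4 p. 464] -/
theorem prop13_4_holds : prop13_4 :=
  prop13_4_of_gaussian gaussianMultiplierKernel_estimates_holds

/-- **Lemma 13.6 of Lemarié-Rieusset 2016 from its localisation step alone**: with Prop. 13.4
proved, `lemma13_6` follows from the named fact `lemma13_6_duhamel` ((13.50)–(13.52)).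
[cite: LemarieRieusset2016, Lemma 13.6 p. 477] -/
theorem lemma13_6_of_duhamel_holds (hD : lemma13_6_duhamel) : lemma13_6 :=
  lemma13_6_of_duhamel prop13_4_holds hD

/-- **The `σ(D)g`-part of Prop. 13.4, proved**: discharge of the named fact
`prop13_4_multiplierPart` (`HeatPotentialHolder.lean`; Lemarié-Rieusset 2016, Prop. 13.4 p. 464,
term `σ(D)g`). [cite: LemarieRieusset2016, Prop. 13.4 p. 464] -/
theorem prop13_4_multiplierPart_holds : prop13_4_multiplierPart :=
  prop13_4_multiplierPart_of_gaussian gaussianMultiplierKernel_estimates_holds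

end LemarieRieusset2016

end Literature.Analysis.FluidPDE
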